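import Literature.Topology.FourManifolds.IsotopyExtensionBoundarylessManifold
import Literature.Topology.FourManifolds.TrackChartExtension
import HarnessLib

/-!
# The isotopy extension theorem for sources with boundary
# (Hirsch, *Differential Topology* (1976), Ch. 8 §1, Thm. 1.3, case `∂V ≠ ∅`)

Fact seat `provefact-Literature.isSmoothlyIsotopic_iff_isAmbientIsotopic` (`Isotopy.lean`).
Hirsch's Theorem 1.3 lets the compact submanifold `V` have a boundary (Ch. 1 §4: submanifolds
are modelled on half-spaces); `IsotopyExtensionBoundarylessManifold.lean` proved the theorem for
sources without boundary points and isolated the local input of the partition-of-unity step as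
the property `SmoothIsotopy.VelocityExtendsLocally`.  This file supplies that input over
**boundary points of a source modelled on the half-space `𝓡∂ (m + 1)`** and deduces Thm. 1.3
for such sources:

* `Literature.Topology.FourManifolds.SmoothIsotopy.velocityExtendsLocallyNear_track_of_chartData`
  — the local extension of the (cut-off) velocity field near a track point `(t₀, F_{t₀} x₀)`
  from chart-level data: `C^∞` extensions, to an open neighbourhood of `(t₀, φ x₀)` in
  `ℝ × EM`, of the chart expression `(s, u) ↦ ψ (F_s (φ⁻¹ u))` of the track and of the
  coordinates of the velocity in the trivialization of `TN` at `F_{t₀} x₀` (any model `I`;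
  the left inverse of the track is `SmoothIsotopy.exists_chartLeftInverse_of_extension`,
  `TrackChartExtension.lean`);
* `Literature.Topology.FourManifolds.SmoothIsotopy.velocityExtendsLocallyNear_track_halfSpace`,
  `Literature.Topology.FourManifolds.SmoothIsotopy.velocityExtendsLocally_halfSpace` — for
  `I = 𝓡∂ (m + 1)` the data exist at every point: over interior points by
  `velocityExtendsLocallyNear_track_of_isInteriorPoint`, over boundary points by **Seeley's
  extension theorem** (`exists_contDiffOn_extension_timeHalfSpace`: the chart expressions are
  `C^∞` within `ℝ × {u | 0 ≤ u 0}` on an open set, hence extend across the hyperplane, jointly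
  in time);
* `Literature.Topology.FourManifolds.isAmbientIsotopic_of_isSmoothlyIsotopic_halfSpace`,
  `Literature.Topology.FourManifolds.isSmoothlyIsotopic_iff_isAmbientIsotopic_halfSpace` —
  **Thm. 1.3 for compact sources with boundary** (model `𝓡∂ (m + 1)`) in closed targets
  without boundary points: the named facts `isAmbientIsotopic_of_isSmoothlyIsotopic`,
  `isSmoothlyIsotopic_iff_isAmbientIsotopic` of `Isotopy.lean` at `I = 𝓡∂ (m + 1)`.

Together with the boundaryless cases (`IsotopyExtension.lean` for boundaryless models,
`IsotopyExtensionBoundarylessManifold.lean` for manifolds without boundary points) this proves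
the named facts of `Isotopy.lean` — Hirsch's Thm. 1.3 with the ambient manifold closed and
without boundary points — for sources `V = M` that are compact manifolds with or without
boundary in the standard models; the facts themselves quantify over arbitrary models with
corners on the source, for which the extension step would need a Whitney-type extension
theorem on the model's range (not available).  What is NOT here: Hirsch's refinements for
non-compact ambient manifolds (compactly supported diffeotopy) and the case
`F(V × I) ⊂ ∂M`.

## References

* M. W. Hirsch, *Differential Topology*, GTM 33, Springer (1976), Ch. 8 §1, Thm. 1.3 and its
  proof, pp. 179–180; Ch. 1 §4, p. 30 (submanifolds with boundary). [HirschDT1976]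
* R. T. Seeley, *Extension of `C^∞` functions defined in a half space*, Proc. Amer. Math.
  Soc. 15 (1964), 625–626. [Seeley1964]
-/

open scoped Manifold ContDiff Topology
open Set Function Filter

noncomputable section

namespace Literature.Topology.FourManifolds

namespace SmoothIsotopy

section ChartData

variable {EM HM EN HN : Type*} [NormedAddCommGroup EM] [NormedSpace ℝ EM] [TopologicalSpace HM]
  [NormedAddCommGroup EN] [NormedSpace ℝ EN] [TopologicalSpace HN]
  {I : ModelWithCorners ℝ EM HM} {J : ModelWithCorners ℝ EN HN}
  {M : Type*} [TopologicalSpace M] [ChartedSpace HM M]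
  {N : Type*} [TopologicalSpace N] [ChartedSpace HN N]
  {f g : M → N} (F : SmoothIsotopy I J f g)

/-- **Local extension of the velocity field near a track point, from chart-level data.**  Let
`φ` be a chart of `M` at `x₀`, `ψ` a chart of the maximal atlas of `N` at `y₀ = F_{t₀} x₀`, `e`
a splitting in which the stage `F_{t₀}` has Mathlib's immersion normal form, and suppose given
`C^∞` maps `k̃`, `Ṽ` on open neighbourhoods of `(t₀, φ x₀)` in `ℝ × EM` which agree, at the chart
points where these are meaningful, with the chart expression `ψ (F_s (φ⁻¹ u))` of the track and
with the coordinates of the velocity `∂F/∂t (s, φ⁻¹ u)` in the trivialization of `TN` at `y₀`.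
Then the velocity field, cut off by a smooth `ρ`, extends near the track point
(`VelocityExtendsLocallyNear`): `G (t, y) = e_{y₀}⁻¹ (ρ t • Ṽ (Λ (t, y)))` with `Λ` the
chart-level left inverse of the track (`exists_chartLeftInverse_of_extension`).  Hirsch (1976),
Ch. 8 §1, proof of Thm. 1.3 (extension of the horizontal part near the track).
[cite: HirschDT1976, Ch. 8 §1, proof of Thm. 1.3] -/
theorem velocityExtendsLocallyNear_track_of_chartData [IsManifold I ∞ M] [IsManifold J ∞ N]
    [CompactSpace M] [T2Space N] [FiniteDimensional ℝ EN] {ρ : ℝ → ℝ} (hρ : ContDiff ℝ ∞ ρ)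
    {t₀ : ℝ} {x₀ : M} (φ : OpenPartialHomeomorph M HM) (ψ : OpenPartialHomeomorph N HN)
    {F' : Type*} [NormedAddCommGroup F'] [NormedSpace ℝ F'] (e : (EM × F') ≃L[ℝ] EN)
    (hψ : ψ ∈ IsManifold.maximalAtlas J ∞ N) (hxφ : x₀ ∈ φ.source)
    (hyψ : F.toFun t₀ x₀ ∈ ψ.source)
    (hwr : EqOn (ψ.extend J ∘ F.toFun t₀ ∘ (φ.extend I).symm) (e ∘ fun u => (u, (0 : F')))
      (φ.extend I).target)
    {k : ℝ × EM → EN} {O : Set (ℝ × EM)} (hO : IsOpen O) (h₀ : (t₀, φ.extend I x₀) ∈ O)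
    (hk : ContDiffOn ℝ ∞ k O)
    (hagree : ∀ p ∈ O, p.2 ∈ (φ.extend I).target →
      F.toFun p.1 ((φ.extend I).symm p.2) ∈ ψ.source → k p = F.trackChart φ ψ p)
    {V : ℝ × EM → EN} {O₂ : Set (ℝ × EM)} (hO₂ : IsOpen O₂) (h₀₂ : (t₀, φ.extend I x₀) ∈ O₂)
    (hV : ContDiffOn ℝ ∞ V O₂)
    (hVagree : ∀ p ∈ O₂, p.2 ∈ (φ.extend I).target →
      F.toFun p.1 ((φ.extend I).symm p.2) ∈ (chartAt HN (F.toFun t₀ x₀)).source →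
      V p = (trivializationAt EN (TangentSpace J) (F.toFun t₀ x₀)
        ⟨F.toFun p.1 ((φ.extend I).symm p.2), F.velocity (p.1, (φ.extend I).symm p.2)⟩).2) :
    F.VelocityExtendsLocallyNear ρ (F.track (t₀, x₀)) := by
  obtain ⟨U₁, hU₁o, -, Λ, hΛ, hΛO, W, hWo, hqW, hWU, hΛtr⟩ :=
    F.exists_chartLeftInverse_of_extension φ ψ e hψ hxφ hyψ hwr hO h₀ hk hagree
  set y₀ : N := F.toFun t₀ x₀ with hy₀
  set eN := trivializationAt EN (TangentSpace J) y₀ with heN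
  -- localisation: track points near `(t₀, y₀)` come from `W ∩ (ℝ × φ.source)`
  obtain ⟨U₂, hU₂o, hpU₂, hU₂W⟩ := F.exists_isOpen_preimage_track_subset
    ((hWo.inter (φ.open_source.preimage continuous_snd)).mem_nhds ⟨hqW, hxφ⟩)
  -- the neighbourhood
  set U : Set (ℝ × N) := (U₁ ∩ Λ ⁻¹' O₂) ∩ U₂ ∩ {p | p.2 ∈ (chartAt HN y₀).source} with hU
  have hUo : IsOpen U :=
    ((hΛ.continuousOn.isOpen_inter_preimage hU₁o hO₂).inter hU₂o).inter
      ((chartAt HN y₀).open_source.preimage continuous_snd)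
  have htr₀ : Λ (F.track (t₀, x₀)) = (t₀, φ.extend I x₀) := hΛtr _ hqW
  have hpU : F.track (t₀, x₀) ∈ U := by
    refine ⟨⟨⟨hWU hqW, ?_⟩, hpU₂⟩, mem_chart_source HN y₀⟩
    rw [mem_preimage, htr₀]
    exact h₀₂
  -- the local field
  set G : ∀ p : ℝ × N, TangentSpace J p.2 := fun p => eN.symmL ℝ p.2 (ρ p.1 • V (Λ p)) with hG
  refine ⟨U, hUo, hpU, G, ?_, ?_, ?_⟩
  · -- smoothness on `U`, through the trivialization `eN`
    have hmaps : MapsTo (fun p : ℝ × N => (⟨p.2, G p⟩ : TangentBundle J N)) U eN.source := by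
      intro p hp
      rw [eN.mem_source, heN, TangentBundle.trivializationAt_baseSet]
      exact hp.2
    refine (eN.contMDiffOn_iff hmaps).2 ⟨contMDiffOn_snd, ?_⟩
    have hcoef : ContMDiffOn (𝓘(ℝ, ℝ).prod J) 𝓘(ℝ, EN) ∞ (fun p : ℝ × N => ρ p.1 • V (Λ p)) U :=
      ((hρ.comp contDiff_id).contMDiff.comp contMDiff_fst).contMDiffOn.smul
        (hV.contMDiffOn.comp (hΛ.mono fun p hp => hp.1.1.1) fun p hp => hp.1.1.2)
    refine hcoef.congr fun p hp => ?_
    have hb : p.2 ∈ eN.baseSet := by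
      rw [heN, TangentBundle.trivializationAt_baseSet]; exact hp.2
    change (eN ⟨p.2, eN.symmL ℝ p.2 (ρ p.1 • V (Λ p))⟩).2 = ρ p.1 • V (Λ p)
    rw [eN.symmL_apply hb, eN.apply_mk_symm hb]
  · -- value on the track
    intro q hq
    obtain ⟨hqW', hq2⟩ := hU₂W hq.1.2
    have hq2 : q.2 ∈ φ.source := hq2
    have hb : F.toFun q.1 q.2 ∈ eN.baseSet := by
      rw [heN, TangentBundle.trivializationAt_baseSet]; exact hq.2
    have hΛq : Λ (F.track q) = (q.1, φ.extend I q.2) := hΛtr q hqW'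
    have hΛqO : (q.1, φ.extend I q.2) ∈ O₂ := by
      have h := hq.1.1.2
      rwa [mem_preimage, hΛq] at h
    have hT : φ.extend I q.2 ∈ (φ.extend I).target :=
      (φ.extend I).map_source (by rwa [φ.extend_source])
    have hVq : V (q.1, φ.extend I q.2) = (eN ⟨F.toFun q.1 q.2, F.velocity q⟩).2 := by
      have h := hVagree _ hΛqO hT (by rw [φ.extend_left_inv hq2]; exact hq.2)
      rw [φ.extend_left_inv hq2] at h
      exact h
    change eN.symmL ℝ (F.toFun q.1 q.2) (ρ q.1 • V (Λ (F.track q))) = ρ q.1 • F.velocity q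
    rw [hΛq, map_smul, hVq, eN.symmL_apply hb, eN.symm_apply_apply_mk hb]
  · -- vanishing where `ρ` vanishes
    intro p _ hρ0
    change eN.symmL ℝ p.2 (ρ p.1 • V (Λ p)) = 0
    rw [hρ0, zero_smul]
    exact (eN.symmL ℝ p.2).map_zero

end ChartData

/-! ### Sources modelled on a half-space -/

section HalfSpace

variable {EN HN : Type*} [NormedAddCommGroup EN] [NormedSpace ℝ EN] [TopologicalSpace HN]
  {J : ModelWithCorners ℝ EN HN} {N : Type*} [TopologicalSpace N] [ChartedSpace HN N]
  {m : ℕ} {M : Type*} [TopologicalSpace M] [ChartedSpace (EuclideanHalfSpace (m + 1)) M]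
  {f g : M → N} (F : SmoothIsotopy (𝓡∂ (m + 1)) J f g)

/-- For a source modelled on the half-space `𝓡∂ (m + 1)`: the preimage of an open set of `N`
under `(s, u) ↦ F_s (φ⁻¹ u)`, `u` ranging over the open set `(𝓡∂ (m + 1))⁻¹' φ.target` of the
model vector space (on which `φ⁻¹ ∘ (𝓡∂ (m + 1))⁻¹` is continuous, the model's inverse being the
continuous retraction onto the half-space), is open. [folklore] -/
theorem isOpen_preimage_stage_comp_extend_symm
    (φ : OpenPartialHomeomorph M (EuclideanHalfSpace (m + 1)))
    {S : Set N} (hS : IsOpen S) :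
    IsOpen {p : ℝ × EuclideanSpace ℝ (Fin (m + 1)) | p.2 ∈ (𝓡∂ (m + 1)).symm ⁻¹' φ.target ∧
      F.toFun p.1 ((φ.extend (𝓡∂ (m + 1))).symm p.2) ∈ S} := by
  have hc : ContinuousOn
      (fun p : ℝ × EuclideanSpace ℝ (Fin (m + 1)) => F.toFun p.1 ((φ.extend (𝓡∂ (m + 1))).symm p.2))
      ((univ : Set ℝ) ×ˢ ((𝓡∂ (m + 1)).symm ⁻¹' φ.target)) := by
    refine F.contMDiff.continuous.comp_continuousOn (continuousOn_fst.prodMk ?_)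
    have h1 : ContinuousOn (φ.extend (𝓡∂ (m + 1))).symm ((𝓡∂ (m + 1)).symm ⁻¹' φ.target) := by
      rw [φ.extend_coe_symm]
      exact φ.continuousOn_symm.comp (𝓡∂ (m + 1)).continuous_symm.continuousOn fun u hu => hu
    exact h1.comp continuousOn_snd fun p hp => hp.2
  have h := hc.isOpen_inter_preimage (isOpen_univ.prod (φ.open_target.preimage
    (𝓡∂ (m + 1)).continuous_symm)) hS
  convert h using 1
  ext p
  simp only [mem_setOf_eq, mem_inter_iff, mem_prod, mem_univ, true_and, mem_preimage]

omit [ChartedSpace (EuclideanHalfSpace (m + 1)) M] in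
/-- In the half-space model, a chart value `u` with `0 ≤ u 0` over the open set
`(𝓡∂ (m + 1))⁻¹' φ.target` lies in the target of the extended chart. [folklore] -/
theorem _root_.Literature.Topology.FourManifolds.mem_extend_target_halfSpace
    (φ : OpenPartialHomeomorph M (EuclideanHalfSpace (m + 1)))
    {u : EuclideanSpace ℝ (Fin (m + 1))} (hu : u ∈ (𝓡∂ (m + 1)).symm ⁻¹' φ.target) (hu0 : 0 ≤ u 0) :
    u ∈ (φ.extend (𝓡∂ (m + 1))).target := by
  rw [φ.extend_target]
  exact ⟨hu, by rw [range_modelWithCornersEuclideanHalfSpace]; exact hu0⟩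

/-- **The velocity field extends near every track point of an isotopy of a compact manifold
with boundary (half-space model).**  Over an interior point this is
`velocityExtendsLocallyNear_track_of_isInteriorPoint`; over a boundary point `x₀` the chart
expression `ψ (F_s (φ⁻¹ u))` of the track in immersion charts of the stage `F_{t₀}` and the
coordinates of the velocity in the trivialization of `TN` at `F_{t₀} x₀` are `C^∞` within
`ℝ × {u | 0 ≤ u 0}` on open sets, hence extend across the boundary hyperplane by Seeley's
theorem (`exists_contDiffOn_extension_timeHalfSpace`), and
`velocityExtendsLocallyNear_track_of_chartData` applies.  Hirsch (1976), Ch. 8 §1, proof of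
Thm. 1.3, for `V` with `∂V ≠ ∅`. [cite: HirschDT1976, Ch. 8 §1, proof of Thm. 1.3] -/
theorem velocityExtendsLocallyNear_track_halfSpace [IsManifold (𝓡∂ (m + 1)) ∞ M] [CompactSpace M]
    [IsManifold J ∞ N] [T2Space N] [FiniteDimensional ℝ EN] {ρ : ℝ → ℝ} (hρ : ContDiff ℝ ∞ ρ)
    (t₀ : ℝ) (x₀ : M) : F.VelocityExtendsLocallyNear ρ (F.track (t₀, x₀)) := by
  by_cases hint : (𝓡∂ (m + 1)).IsInteriorPoint x₀
  · exact F.velocityExtendsLocallyNear_track_of_isInteriorPoint hρ hint t₀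
  haveI : CompleteSpace EN := FiniteDimensional.complete ℝ EN
  -- immersion charts for the stage `F_{t₀}` at `x₀`
  have himm : Manifold.IsImmersionAt (𝓡∂ (m + 1)) J ∞ (F.toFun t₀) x₀ :=
    (F.isSmoothEmbedding t₀).isImmersion.isImmersionAt x₀
  set φ := himm.domChart with hφ_def
  set ψ := himm.codChart with hψ_def
  set e := himm.equiv with he_def
  have hφ : φ ∈ IsManifold.maximalAtlas (𝓡∂ (m + 1)) ∞ M := himm.domChart_mem_maximalAtlas
  have hψ : ψ ∈ IsManifold.maximalAtlas J ∞ N := himm.codChart_mem_maximalAtlas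
  have hxφ : x₀ ∈ φ.source := himm.mem_domChart_source
  have hyψ : F.toFun t₀ x₀ ∈ ψ.source := himm.mem_codChart_source
  have hwr : EqOn (ψ.extend J ∘ F.toFun t₀ ∘ (φ.extend (𝓡∂ (m + 1))).symm)
      (e ∘ fun u => (u, (0 : himm.complement))) (φ.extend (𝓡∂ (m + 1))).target :=
    himm.writtenInCharts
  -- the chart value of the boundary point lies on the hyperplane `{u 0 = 0}`
  set u₀ : EuclideanSpace ℝ (Fin (m + 1)) := φ.extend (𝓡∂ (m + 1)) x₀ with hu₀
  have hu₀T : u₀ ∈ (φ.extend (𝓡∂ (m + 1))).target :=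
    (φ.extend (𝓡∂ (m + 1))).map_source (by rwa [φ.extend_source])
  have hu₀φ : u₀ ∈ (𝓡∂ (m + 1)).symm ⁻¹' φ.target := by
    have h := hu₀T
    rw [φ.extend_target] at h
    exact h.1
  have hu₀0 : u₀ 0 = 0 := by
    have h1 : 0 ≤ u₀ 0 := by
      have h := (φ.extend (𝓡∂ (m + 1))).map_source (by rwa [φ.extend_source] : x₀ ∈ _)
      rw [φ.extend_target] at h
      have h2 := h.2
      rw [range_modelWithCornersEuclideanHalfSpace] at h2
      exact h2
    have h2 : ¬ (0 < u₀ 0) := by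
      intro hlt
      apply hint
      rw [isInteriorPoint_iff_of_mem_maximalAtlas (by simp) hφ hxφ,
        interior_range_modelWithCornersEuclideanHalfSpace]
      exact hlt
    linarith [not_lt.1 h2]
  have hsymm₀ : (φ.extend (𝓡∂ (m + 1))).symm u₀ = x₀ := φ.extend_left_inv hxφ
  -- (a) Seeley extension of the chart expression of the track
  set O₁ : Set (ℝ × EuclideanSpace ℝ (Fin (m + 1))) := {p | p.2 ∈ (𝓡∂ (m + 1)).symm ⁻¹' φ.target ∧
    F.toFun p.1 ((φ.extend (𝓡∂ (m + 1))).symm p.2) ∈ ψ.source} with hO₁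
  have hO₁o : IsOpen O₁ := F.isOpen_preimage_stage_comp_extend_symm φ ψ.open_source
  have hp₀O₁ : (t₀, u₀) ∈ O₁ := ⟨hu₀φ, by simpa only [hsymm₀] using hyψ⟩
  have hk₁ : ContDiffOn ℝ ∞ (F.trackChart φ ψ) (O₁ ∩ {p | 0 ≤ p.2 0}) :=
    (F.contDiffOn_trackChart' φ ψ hφ hψ).mono fun p hp =>
      ⟨mem_extend_target_halfSpace φ hp.1.1 hp.2, hp.1.2⟩
  obtain ⟨O, hOo, hp₀O, -, k, hk, hkeq⟩ :=
    exists_contDiffOn_extension_timeHalfSpace hO₁o hp₀O₁ hu₀0 hk₁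
  have hagree : ∀ p ∈ O, p.2 ∈ (φ.extend (𝓡∂ (m + 1))).target →
      F.toFun p.1 ((φ.extend (𝓡∂ (m + 1))).symm p.2) ∈ ψ.source → k p = F.trackChart φ ψ p := by
    intro p hp hpT _
    refine hkeq ⟨hp, ?_⟩
    rw [φ.extend_target, range_modelWithCornersEuclideanHalfSpace] at hpT
    exact hpT.2
  -- (b) Seeley extension of the coordinates of the velocity
  set y₀ : N := F.toFun t₀ x₀ with hy₀
  set eN := trivializationAt EN (TangentSpace J) y₀ with heN
  set Vc : ℝ × EuclideanSpace ℝ (Fin (m + 1)) → EN := fun p =>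
    (eN ⟨F.toFun p.1 ((φ.extend (𝓡∂ (m + 1))).symm p.2),
      F.velocity (p.1, (φ.extend (𝓡∂ (m + 1))).symm p.2)⟩).2 with hVc
  set O₂ : Set (ℝ × EuclideanSpace ℝ (Fin (m + 1))) := {p | p.2 ∈ (𝓡∂ (m + 1)).symm ⁻¹' φ.target ∧
    F.toFun p.1 ((φ.extend (𝓡∂ (m + 1))).symm p.2) ∈ (chartAt HN y₀).source} with hO₂
  have hO₂o : IsOpen O₂ := F.isOpen_preimage_stage_comp_extend_symm φ (chartAt HN y₀).open_source
  have hp₀O₂ : (t₀, u₀) ∈ O₂ := ⟨hu₀φ, by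
    show F.toFun t₀ ((φ.extend (𝓡∂ (m + 1))).symm u₀) ∈ (chartAt HN y₀).source
    rw [hsymm₀]; exact mem_chart_source HN y₀⟩
  have hVc₁ : ContDiffOn ℝ ∞ Vc (O₂ ∩ {p | 0 ≤ p.2 0}) := by
    -- the velocity coordinates on `ℝ × M` near `(t₀, x₀)`
    set Q₀ : Set (ℝ × M) := {q | F.toFun q.1 q.2 ∈ (chartAt HN y₀).source} with hQ₀
    have hmaps : MapsTo (fun q : ℝ × M => (⟨F.toFun q.1 q.2, F.velocity q⟩ : TangentBundle J N))
        Q₀ eN.source := by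
      intro q hq
      rw [eN.mem_source, heN, TangentBundle.trivializationAt_baseSet]
      exact hq
    have hW : ContMDiffOn (𝓘(ℝ, ℝ).prod (𝓡∂ (m + 1))) 𝓘(ℝ, EN) ∞
        (fun q : ℝ × M => (eN ⟨F.toFun q.1 q.2, F.velocity q⟩).2) Q₀ :=
      ((eN.contMDiffOn_iff hmaps).1 F.contMDiff_velocity.contMDiffOn).2
    -- composed with `(s, u) ↦ (s, φ⁻¹ u)`, smooth within the chart target
    have h1 : ContMDiffOn 𝓘(ℝ, ℝ × EuclideanSpace ℝ (Fin (m + 1))) (𝓘(ℝ, ℝ).prod (𝓡∂ (m + 1))) ∞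
        (fun p : ℝ × EuclideanSpace ℝ (Fin (m + 1)) =>
          ((p.1, (φ.extend (𝓡∂ (m + 1))).symm p.2) : ℝ × M))
        (O₂ ∩ {p | 0 ≤ p.2 0}) := by
      refine (contDiff_fst.contMDiff.contMDiffOn).prodMk ?_
      refine (contMDiffOn_extend_symm hφ).comp contDiff_snd.contMDiff.contMDiffOn fun p hp => ?_
      rw [← φ.extend_target']
      exact mem_extend_target_halfSpace φ hp.1.1 hp.2
    have h2 := hW.comp h1 fun p hp => hp.1.2
    exact contMDiffOn_iff_contDiffOn.1 h2
  obtain ⟨O', hO'o, hp₀O', -, V, hV, hVeq⟩ :=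
    exists_contDiffOn_extension_timeHalfSpace hO₂o hp₀O₂ hu₀0 hVc₁
  have hVagree : ∀ p ∈ O', p.2 ∈ (φ.extend (𝓡∂ (m + 1))).target →
      F.toFun p.1 ((φ.extend (𝓡∂ (m + 1))).symm p.2) ∈ (chartAt HN (F.toFun t₀ x₀)).source →
      V p = (trivializationAt EN (TangentSpace J) (F.toFun t₀ x₀)
        ⟨F.toFun p.1 ((φ.extend (𝓡∂ (m + 1))).symm p.2),
          F.velocity (p.1, (φ.extend (𝓡∂ (m + 1))).symm p.2)⟩).2 := by
    intro p hp hpT _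
    refine hVeq ⟨hp, ?_⟩
    rw [φ.extend_target, range_modelWithCornersEuclideanHalfSpace] at hpT
    exact hpT.2
  exact F.velocityExtendsLocallyNear_track_of_chartData hρ φ ψ e hψ hxφ hyψ hwr hOo hp₀O hk
    hagree hO'o hp₀O' hV hVagree

/-- **Compact sources with boundary (half-space model) have the local extension property.**
[cite: HirschDT1976, Ch. 8 §1, proof of Thm. 1.3] -/
theorem velocityExtendsLocally_halfSpace [IsManifold (𝓡∂ (m + 1)) ∞ M] [CompactSpace M]
    [IsManifold J ∞ N] [T2Space N] [FiniteDimensional ℝ EN] {ρ : ℝ → ℝ} (hρ : ContDiff ℝ ∞ ρ) :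
    F.VelocityExtendsLocally ρ :=
  F.velocityExtendsLocally_of_forall_track fun q =>
    F.velocityExtendsLocallyNear_track_halfSpace hρ q.1 q.2

end HalfSpace

end SmoothIsotopy

/-! ### Theorem 1.3 for sources with boundary -/

section Facts

variable {EN HN : Type*} [NormedAddCommGroup EN] [NormedSpace ℝ EN] [TopologicalSpace HN]
  {J : ModelWithCorners ℝ EN HN} {N : Type*} [TopologicalSpace N] [ChartedSpace HN N]
  {m : ℕ} {M : Type*} [TopologicalSpace M] [ChartedSpace (EuclideanHalfSpace (m + 1)) M]
  {f g : M → N}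

/-- **Isotopy extension theorem for compact sources with boundary** (Hirsch, *Differential
Topology* (1976), Ch. 8 §1, Thm. 1.3, `∂V ≠ ∅` allowed, `F(V × I) ⊂ M - ∂M`): smoothly isotopic
smooth embeddings of a compact manifold with boundary `M` (model `𝓡∂ (m + 1)`) into a closed
manifold `N` (compact, Hausdorff, without boundary points) are ambient isotopic — the named fact
`Literature.Topology.FourManifolds.isAmbientIsotopic_of_isSmoothlyIsotopic` of `Isotopy.lean` at
`I = 𝓡∂ (m + 1)`. [cite: HirschDT1976, Ch. 8 §1, Thm. 1.3] -/
theorem isAmbientIsotopic_of_isSmoothlyIsotopic_halfSpace :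
    isAmbientIsotopic_of_isSmoothlyIsotopic (I := 𝓡∂ (m + 1)) (J := J) (f := f) (g := g) := by
  intro _ _ _ _ _ _ hfg
  obtain ⟨F⟩ := hfg
  cases isEmpty_or_nonempty M with
  | inl hM =>
    exact ⟨.refl, funext fun x => (IsEmpty.false x).elim⟩
  | inr hM =>
    haveI : Nonempty N := ⟨f (Classical.arbitrary M)⟩
    haveI : FiniteDimensional ℝ EN := Manifold.finiteDimensional_of_compactSpace J N
    obtain ⟨Ψ, hΨ⟩ := F.exists_ambientIsotopy_comp_eq_of_velocityExtendsLocally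
      (F.velocityExtendsLocally_halfSpace contDiff_timeCutoff)
    refine ⟨Ψ, funext fun x => ?_⟩
    have h := hΨ 1 ⟨by norm_num, by norm_num⟩ x
    rw [F.map_zero, F.map_one] at h
    exact h

/-- For embeddings of a compact manifold with boundary (model `𝓡∂ (m + 1)`) into a closed
manifold, **smooth isotopy and ambient isotopy agree**: the named fact
`Literature.Topology.FourManifolds.isSmoothlyIsotopic_iff_isAmbientIsotopic` of `Isotopy.lean` at
`I = 𝓡∂ (m + 1)` (Hirsch (1976), Ch. 8 §1, Thm. 1.3 with the elementary converse
`IsAmbientIsotopic.isSmoothlyIsotopic_holds`). [cite: HirschDT1976, Ch. 8 §1, Thm. 1.3] -/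
theorem isSmoothlyIsotopic_iff_isAmbientIsotopic_halfSpace :
    isSmoothlyIsotopic_iff_isAmbientIsotopic (I := 𝓡∂ (m + 1)) (J := J) (f := f) (g := g) := by
  intro _ _ _ _ _ _ hf
  exact ⟨fun h => isAmbientIsotopic_of_isSmoothlyIsotopic_halfSpace h,
    fun h => IsAmbientIsotopic.isSmoothlyIsotopic_holds hf h⟩

end Facts

end Literature.Topology.FourManifolds
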